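import Summits.Schanuel.Schanuel.Theorems.DiophantineDichotomyApproximationPropertyCycleAPIAt3Defs
import Summits.Schanuel.Schanuel.Theorems.DiophantineDichotomyApproximationPropertyCycleAPIAt3GlueLemmas
import Summits.Schanuel.Schanuel.Theorems.DiophantineDichotomyApproximationPropertyPointDatumOfLineSatellite
import HarnessLib

/-!
# Stub `pointDatum_of_lineSatellite3_log` of line `orbit-interpolation-determinant` (crux `ApproximationProperty`, stmt-Schanuel-6117)

Crux `stmt-Schanuel-6117` (`Summit.Schanuel.Schanuel.Theses.DiophantineDichotomy.ApproximationProperty`),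
route `DiophantineDichotomy`, line `orbit-interpolation-determinant`, registered stub
`pointDatum_of_lineSatellite3_log` (the LINE-satellite branch of the bad cut of the `t = 3` transfer,
run from the LOGARITHMIC orbit floor; vocabulary `…CycleAPIAt3Defs.lean`: `OrbitFloor`,
`SatelliteHeightLine`, `ContainerRestart`).

The statement is that of the landed `pointDatum_of_lineSatellite3`
(`…PointDatumOfLineSatellite.lean`) with its first hypothesis `OrbitFloor`
(`log (1/|𝔭(ω̄)|) ≤ C (δₛ L + h + D log(D+2) + √(D (h + D + δₛ log(D+2)) L))` for a prime orbit
`𝔭` on a `ℚ`-curve `V(𝔮)` all of whose points are `e^{−L}`-far from `ω̄`) replaced by the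
LOG floor: the same inequality with one extra summand `D log(L + 2)` inside `C (…)`.

Proof: the extra summand is harmless at the level of the STATEMENTS. For `D ≥ 1`, `L ≥ 0` one has
`L + 2 ≤ (L/D + 1)(D + 2)`, hence `D log(L+2) ≤ D log(1 + L/D) + D log(D+2) ≤ L + D log(D+2)`
(`log(1 + x) ≤ x`), and `L ≤ δₛ L` because `δₛ = deg 𝔮 ≥ 1`
(`SatelliteRestartGlue.one_le_ideg_two`). So the LOG floor with constant `C(ω)` implies
`OrbitFloor` with constant `2 C(ω)` (`PointDatumOfLineSatelliteLog.orbitFloor_of_logFloor`), and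
the landed `pointDatum_of_lineSatellite3` (floor contrapositive, `SatelliteHeightLine`,
`ContainerRestart`, `rankOne_interpolation_of_ideg_le`, `pointDatum_of_clause`) finishes.
Proofs only (no definitions, no named facts).

Sources: NesterenkoPhilippon2001 (LNM 1752) Ch. 3 §4 (Prop. 4.11, Cor. 4.10), Ch. 4 §4 p. 61
(AP1/AP2 for `n = 3`); Philippon2000 (doi:10.1006/jnth.1999.2461); folklore real analysis.
-/

noncomputable section

-- `Summit.Schanuel.Schanuel.…` is the mandated summit/sub-problem namespace (single-conjunct summit), hence:
set_option linter.dupNamespace false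

attribute [local instance] MvPolynomial.gradedAlgebra

namespace Summit.Schanuel.Schanuel.Cruxes.ApproximationProperty.OrbitInterpolationDeterminant

open Literature.NumberTheory.Transcendental.Nesterenko MvPolynomial
open scoped BigOperators

namespace PointDatumOfLineSatelliteLog

/-! ## Real arithmetic: the extra `D log(L+2)` summand is dominated by `L + D log(D+2)` -/

/-- `D log(L + 2) ≤ L + D log(D + 2)` for real `D ≥ 1`, `L ≥ 0`: indeed
`L + 2 ≤ (L/D + 1)(D + 2)` and `log(1 + L/D) ≤ L/D`. [folklore] -/
theorem mul_log_add_two_le {D L : ℝ} (hD : 1 ≤ D) (hL : 0 ≤ L) :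
    D * Real.log (L + 2) ≤ L + D * Real.log (D + 2) := by
  have hD0 : 0 < D := by linarith
  have hLD : 0 ≤ L / D := div_nonneg hL hD0.le
  have e : L / D * D = L := div_mul_cancel₀ L hD0.ne'
  have h1 : L + 2 ≤ (L / D + 1) * (D + 2) := by nlinarith [e, hLD]
  have h2 : Real.log (L + 2) ≤ Real.log (L / D + 1) + Real.log (D + 2) := by
    rw [← Real.log_mul (by positivity) (by positivity)]
    exact Real.log_le_log (by linarith) h1
  have h3 : Real.log (L / D + 1) ≤ L / D := by
    have := Real.log_le_sub_one_of_pos (by positivity : 0 < L / D + 1)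
    linarith
  calc D * Real.log (L + 2) ≤ D * (L / D + Real.log (D + 2)) :=
        mul_le_mul_of_nonneg_left (by linarith) hD0.le
    _ = L + D * Real.log (D + 2) := by rw [mul_add, mul_div_cancel₀ _ hD0.ne']

/-- `D log(L + 2) ≤ L + D log(D + 2)` for a natural number `D` and real `L ≥ 0` (the case
`D = 0` being trivial). [folklore] -/
theorem natCast_mul_log_add_two_le (D : ℕ) {L : ℝ} (hL : 0 ≤ L) :
    (D : ℝ) * Real.log (L + 2) ≤ L + (D : ℝ) * Real.log ((D : ℝ) + 2) := by
  rcases Nat.eq_zero_or_pos D with rfl | hD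
  · simpa using hL
  · exact mul_log_add_two_le (by exact_mod_cast hD) hL

/-- **The LOG floor implies the orbit floor.** If for every `ω` there is `C(ω) > 0` with
`log (1/|𝔭(ω̄)|) ≤ C (δₛ L + h + D log(D+2) + D log(L+2) + √(D (h + D + δₛ log(D+2)) L))` for
every prime orbit `𝔭` on a `ℚ`-curve `V(𝔮)` (`δₛ = deg 𝔮`) all of whose points are `e^{−L}`-far
from `ω̄` (`L ≥ 1`), then `OrbitFloor` holds with constant `2 C(ω)`: `D log(L+2) ≤ L + D log(D+2)`
and `L ≤ δₛ L` (`δₛ ≥ 1` for a homogeneous prime of rank `2`).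
[cite: NesterenkoPhilippon2001, Ch. 3 Prop. 4.4 (p. 38), Prop. 4.11 (pp. 40–41)] -/
theorem orbitFloor_of_logFloor (hF : ∀ ω : Fin 3 → ℂ, ∃ C : ℝ, 0 < C ∧ ∀ (𝔭 𝔮 : Ideal (Rx 3)) (L : ℝ), 𝔭.IsPrime → 𝔭.IsHomogeneous (homogeneousSubmodule (Fin (3 + 1)) ℚ) → IsUnmixedOfRank 𝔭 1 → 𝔮.IsPrime → 𝔮.IsHomogeneous (homogeneousSubmodule (Fin (3 + 1)) ℚ) → IsUnmixedOfRank 𝔮 2 → 𝔮 ≤ 𝔭 → 1 ≤ L → (∀ β ∈ projZeros 𝔭, Real.exp (-L) ≤ projDist (Fin.cons 1 ω) β) → Real.log (1 / iabs 𝔭 1 (Fin.cons 1 ω)) ≤ C * ((ideg 𝔮 2 : ℝ) * L + iheight 𝔭 1 + (ideg 𝔭 1 : ℝ) * Real.log ((ideg 𝔭 1 : ℝ) + 2) + (ideg 𝔭 1 : ℝ) * Real.log (L + 2) + Real.sqrt ((ideg 𝔭 1 : ℝ) * (iheight 𝔭 1 + ideg 𝔭 1 + (ideg 𝔮 2 :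 ℝ) * Real.log ((ideg 𝔭 1 : ℝ) + 2)) * L))) :
    OrbitFloor := by
  intro ω
  obtain ⟨C, hC, hFt⟩ := hF ω
  refine ⟨2 * C, by positivity, ?_⟩
  intro 𝔭 𝔮 L h𝔭 h𝔭hom h𝔭unm h𝔮 h𝔮hom h𝔮unm hle hL hfar
  have hup := hFt 𝔭 𝔮 L h𝔭 h𝔭hom h𝔭unm h𝔮 h𝔮hom h𝔮unm hle hL hfar
  have hδ : (1 : ℝ) ≤ (ideg 𝔮 2 : ℝ) := by
    exact_mod_cast SatelliteRestartGlue.one_le_ideg_two h𝔮 h𝔮hom h𝔮unm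
  have hL0 : 0 ≤ L := by linarith
  have hh : 0 ≤ iheight 𝔭 1 := height_nonneg _
  have hsqrt : 0 ≤ Real.sqrt ((ideg 𝔭 1 : ℝ) *
      (iheight 𝔭 1 + ideg 𝔭 1 + (ideg 𝔮 2 : ℝ) * Real.log ((ideg 𝔭 1 : ℝ) + 2)) * L) :=
    Real.sqrt_nonneg _
  have hD0 : (0 : ℝ) ≤ (ideg 𝔭 1 : ℝ) := Nat.cast_nonneg _
  have hlogD : 0 ≤ (ideg 𝔭 1 : ℝ) * Real.log ((ideg 𝔭 1 : ℝ) + 2) :=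
    mul_nonneg hD0 (Real.log_nonneg (by linarith))
  have hkey := natCast_mul_log_add_two_le (ideg 𝔭 1) hL0
  have hLδ : L ≤ (ideg 𝔮 2 : ℝ) * L := le_mul_of_one_le_left hL0 hδ
  calc Real.log (1 / iabs 𝔭 1 (Fin.cons 1 ω))
      ≤ C * ((ideg 𝔮 2 : ℝ) * L + iheight 𝔭 1 + (ideg 𝔭 1 : ℝ) * Real.log ((ideg 𝔭 1 : ℝ) + 2) +
          (ideg 𝔭 1 : ℝ) * Real.log (L + 2) + Real.sqrt ((ideg 𝔭 1 : ℝ) *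
            (iheight 𝔭 1 + ideg 𝔭 1 + (ideg 𝔮 2 : ℝ) * Real.log ((ideg 𝔭 1 : ℝ) + 2)) * L)) := hup
    _ ≤ C * (2 * ((ideg 𝔮 2 : ℝ) * L + iheight 𝔭 1 + (ideg 𝔭 1 : ℝ) * Real.log ((ideg 𝔭 1 : ℝ) + 2) +
          Real.sqrt ((ideg 𝔭 1 : ℝ) *
            (iheight 𝔭 1 + ideg 𝔭 1 + (ideg 𝔮 2 : ℝ) * Real.log ((ideg 𝔭 1 : ℝ) + 2)) * L))) :=
        mul_le_mul_of_nonneg_left (by linarith) hC.le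
    _ = 2 * C * ((ideg 𝔮 2 : ℝ) * L + iheight 𝔭 1 + (ideg 𝔭 1 : ℝ) * Real.log ((ideg 𝔭 1 : ℝ) + 2) +
          Real.sqrt ((ideg 𝔭 1 : ℝ) *
            (iheight 𝔭 1 + ideg 𝔭 1 + (ideg 𝔮 2 : ℝ) * Real.log ((ideg 𝔭 1 : ℝ) + 2)) * L)) := by
        ring

end PointDatumOfLineSatelliteLog

/-- **Stub `pointDatum_of_lineSatellite3_log`** (crux `stmt-Schanuel-6117`, line
`orbit-interpolation-determinant`; the line-satellite branch of the bad cut of the `t = 3` transfer,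
from the LOG floor): `LogFloor → SatelliteHeightLine → ContainerRestart →` for every `ω ∈ ℂ³` and
`c₁ ≥ 1` there are `λ ≥ 1` and `c ≥ c₁` such that, for `Y ≥ Δ ≥ c`, a long prime orbit `𝔭`
(`⌊c₁Δ⌋ + 1 < deg 𝔭`, AP1 bounds at constant `c₁` and scale `(Δ, λY)`) lying on a rational LINE
`V(𝔮')` (`deg 𝔮' = 1`, `𝔮' ∋ Q, P`, `(Q)` prime, `P ∉ (Q)`, `a + b ≤ 3Δ`) yields a
`PointAPAbsAt 3`-datum at `(Δ, Y)`. The LOG floor (orbit floor with the extra summand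
`D log(L+2)`) implies `OrbitFloor` with twice the constant
(`PointDatumOfLineSatelliteLog.orbitFloor_of_logFloor`), and the landed
`pointDatum_of_lineSatellite3` applies verbatim.
[cite: NesterenkoPhilippon2001, Ch. 3 Prop. 4.11 (pp. 40–41), Cor. 4.10; Ch. 4 §4 p. 61] -/
theorem pointDatum_of_lineSatellite3_log : (∀ ω : Fin 3 → ℂ, ∃ C : ℝ, 0 < C ∧ ∀ (𝔭 𝔮 : Ideal (Rx 3)) (L : ℝ), 𝔭.IsPrime → 𝔭.IsHomogeneous (homogeneousSubmodule (Fin (3 + 1)) ℚ) → IsUnmixedOfRank 𝔭 1 → 𝔮.IsPrime → 𝔮.IsHomogeneous (homogeneousSubmodule (Fin (3 + 1)) ℚ) → IsUnmixedOfRank 𝔮 2 → 𝔮 ≤ 𝔭 → 1 ≤ L → (∀ β ∈ projZeros 𝔭, Real.exp (-L) ≤ projDist (Fin.cons 1 ω) β) → Real.log (1 / iabs 𝔭 1 (Fin.cons 1 ω)) ≤ C * ((ideg 𝔮 2 : ℝ) * L + iheight 𝔭 1 + (ideg 𝔭 1 : ℝ) * Real.log ((ideg 𝔭 1 : ℝ)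 + 2) + (ideg 𝔭 1 : ℝ) * Real.log (L + 2) + Real.sqrt ((ideg 𝔭 1 : ℝ) * (iheight 𝔭 1 + ideg 𝔭 1 + (ideg 𝔮 2 : ℝ) * Real.log ((ideg 𝔭 1 : ℝ) + 2)) * L))) → SatelliteHeightLine → ContainerRestart → ∀ (ω : Fin 3 → ℂ) (c₁ : ℝ), 1 ≤ c₁ → ∃ lam : ℝ, 1 ≤ lam ∧ ∃ c : ℝ, c₁ ≤ c ∧ ∀ Δ Y : ℝ, c ≤ Δ → Δ ≤ Y → ∀ (Q : Rx 3) (a : ℕ) (P : Rx 3) (b : ℕ) (𝔮' 𝔭 : Ideal (Rx 3)), Q ≠ 0 → Q.IsHomogeneous a → P.IsHomogeneous b → 1 ≤ a → 1 ≤ b → (a : ℝ) + b ≤ 3 * Δ → (Ideal.span {Q}).IsPrime → P ∉ Ideal.span {Q} → 𝔮'.IsPrime → 𝔮'.IsHomogeneous (homogeneousSubmodule (Fin (3 + 1)) ℚ) → IsUnmixedOfRank 𝔮' 2 → Q ∈ 𝔮' → P ∈ 𝔮' → ideg 𝔮' 2 = 1 → 𝔭.IsPrime → 𝔭.IsHomogeneous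 (homogeneousSubmodule (Fin (3 + 1)) ℚ) → IsUnmixedOfRank 𝔭 1 → 𝔮' ≤ 𝔭 → ⌊c₁ * Δ⌋₊ + 1 < ideg 𝔭 1 → (ideg 𝔭 1 : ℝ) ≤ (c₁ * Δ) ^ 3 → iheight 𝔭 1 ≤ c₁ * (lam * Y) * Δ ^ 2 → iabs 𝔭 1 (Fin.cons 1 ω) ≤ Real.exp (-((Δ * iheight 𝔭 1 + lam * Y * ideg 𝔭 1) / c₁)) → ∃ (K : Type) (_ : Field K) (_ : NumberField K) (β : Fin 3 → K) (σ : K →+* ℂ), (Module.finrank ℚ K : ℝ) ≤ (c * Δ) ^ 3 ∧ Height.logHeight (Fin.cons (1 : K) β : Fin (3 + 1) → K) ≤ c * Y * Δ ^ 2 ∧ ‖(fun j => σ (β j)) - ω‖ ≤ Real.exp (-((Δ * Height.logHeight (Fin.cons (1 : K) β : Fin (3 + 1) → K) + Y * Module.finrank ℚ K) / c)) :=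
  fun hF => pointDatum_of_lineSatellite3 (PointDatumOfLineSatelliteLog.orbitFloor_of_logFloor hF)

end Summit.Schanuel.Schanuel.Cruxes.ApproximationProperty.OrbitInterpolationDeterminant

end
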